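import Summits.QuantumFields.BalabanUV.Beta.EriceRemainderEnclosureHistoryAutonomyComparisonAgeCompositionStaticEndDecay
import Summits.QuantumFields.BalabanUV.Beta.EriceRemainderEnclosureHistoryAutonomyComparisonAgeCompositionEnteringLagLevels

/-!
# EriceRemainderEnclosureHistoryAutonomyComparisonAgeCompositionStaticEndEntering — (E86d) (E83j)'s JOINT INDUCTION RE-CUT WITH THE ENTERING-LAG OPTIONS:
# a multi-lag level may take MONO″ from (S-e) instead of the tail sums (S-b), every pair of ages (MONO) from «decay + defect» (S-h) instead of (S-a)
Cell `pub-balaban`, β-function sub-cell, BINDER row D4 (owner lineage `b2b-balaban-beta-an4`; this file by co-owner #2 lineage `b2b-balaban-beta-d4-p2`,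
generation 77), FREEZE (0) honoured (def-free; imports (E83j) `…StaticEndDecay`, (E86c) `…EnteringLagLevels`; (E83j)'s induction copied with two
branches added and its tail-sum hypotheses made optional; nothing else restated).  HONEST FRAMING (page 1, verbatim and binding).  *"Discharging BetaPertH
makes Bałaban's UV stability UNCONDITIONAL — a real constructive-QFT result; it is NOT the continuum limit and NOT the Clay problem."*  THIS FILE DISCHARGES
NOTHING OF THE KIND.  Elementary real algebra about ABSTRACT renewal systems — hypotheses of a census, not facts; nothing of Bałaban's (1.22) limit functional
is PRINTED ([I] p. 298) or asserted.  Row D4 class UNCHANGED (critical-path width 0; instance 0∕1; D4 DISCHARGE NO DATE).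
THE POINT (route (N); README `HOME/b2b-balaban-beta-d4-p2/g77/e86/README.md` §4).  **`nonneg_and_drop_ratio_all_ages_entering`**: (E83j)
`nonneg_and_drop_ratio_all_ages_decay` with (i) the ONE-LAG STRUCTURE of the lone kernels displayed (`KL k (m+1) l = σ k m·KL k m (l+1)`, `0 ≤ σ ≤ 1`; an
EQUALITY along flows, (E83b) `flow_onelag_structure`); (ii) `hlev` a four-way option for every non-oldest level `i`: one lag ∧ (S-b)ᵢ at `L′=0` ∣ silent ∣
`P(i+1)` ∧ the tail sums (S-b)ᵢ ∣ **`P(i+1)` ∧ (S-e)ᵢ** ((E86c) `mono2_of_entering`) — (E83j)'s `hSb`, `hSbp` are no longer asked of every level; (iii)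
`hMONOopt i k` a four-way option: cumulative domination ((S-a)ₖ) ∣ silent ∣ one lag ∧ (S-d) ∣ **`P(i+1)` ∧ (S-h)_{(i,k)}** ((E86c)
`old_read_antitone_of_decay_defect`, young lower masses `AL i j p = Σ_{l<y_i} [p+1+l ≤ j]·KL i p l·(1 − ρ i (p+1+l))` carrying the edge `j` as `HgS` does;
truncations first, every admissible input by linearity, (E81j) `antitone_of_truncations`).  The END is (E86e).  NOT CLAIMED: any family along flows;
anything printed.  PROVED ([folklore]; 0 `def`, 0 sorry): **`nonneg_and_drop_ratio_all_ages_entering`**.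
-/
noncomputable section
open Finset
namespace Summit.QuantumFields.BalabanUV.Beta.EriceRemainderEnclosureHistoryAutonomyComparisonAgeCompositionStaticEndEntering
open Summit.QuantumFields.BalabanUV.Beta.EriceRemainderEnclosureHistoryAutonomyComparisonAgeComposition
open Summit.QuantumFields.BalabanUV.Beta.EriceRemainderEnclosureHistoryAutonomyComparisonAgeCompositionInduction
open Summit.QuantumFields.BalabanUV.Beta.EriceRemainderEnclosureHistoryAutonomyComparisonAgeCompositionSandwich
open Summit.QuantumFields.BalabanUV.Beta.EriceRemainderEnclosureHistoryAutonomyComparisonAgeCompositionChainWiring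
open Summit.QuantumFields.BalabanUV.Beta.EriceRemainderEnclosureHistoryAutonomyComparisonAgeCompositionChainWiringTerms
open Summit.QuantumFields.BalabanUV.Beta.EriceRemainderEnclosureHistoryAutonomyComparisonAgeCompositionReadDecay
open Summit.QuantumFields.BalabanUV.Beta.EriceRemainderEnclosureHistoryAutonomyComparisonAgeCompositionReadMonotone
open Summit.QuantumFields.BalabanUV.Beta.EriceRemainderEnclosureHistoryAutonomyComparisonAgeCompositionTailSums
open Summit.QuantumFields.BalabanUV.Beta.EriceRemainderEnclosureHistoryAutonomyComparisonAgeCompositionStaticWiring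
open Summit.QuantumFields.BalabanUV.Beta.EriceRemainderEnclosureHistoryAutonomyComparisonAgeCompositionStaticEnd
open Summit.QuantumFields.BalabanUV.Beta.EriceRemainderEnclosureHistoryAutonomyComparisonAgeCompositionDecayRoute
open Summit.QuantumFields.BalabanUV.Beta.EriceRemainderEnclosureHistoryAutonomyComparisonAgeCompositionStaticEndLevels (read_decay_one_lag)
open Summit.QuantumFields.BalabanUV.Beta.EriceRemainderEnclosureHistoryAutonomyComparisonAgeCompositionEnteringLagLevels (mono2_of_entering old_read_antitone_of_decay_defect)

variable {N n : ℕ} {KL KA : ℕ → ℕ → ℕ → ℝ} {RL RA SL SA : ℕ → (ℕ → ℝ) → ℕ → ℝ} {y : ℕ → ℕ} {θ : ℕ → ℕ → ℕ → ℝ}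

/-- **THE JOINT INDUCTION WITH THE ENTERING-LAG OPTIONS.**  As (E83j) `nonneg_and_drop_ratio_all_ages_decay` with the one-lag structure `σ` displayed, the
per-level option `hlev` (one lag ∧ (S-b) at `L′=0` ∣ silent ∣ `P(i+1)` ∧ tail sums ∣ `P(i+1)` ∧ (S-e)) and the per-pair option `hMONOopt` (cumulative
domination ∣ silent ∣ one lag ∧ (S-d) ∣ `P(i+1)` ∧ (S-h)). [folklore] -/
theorem nonneg_and_drop_ratio_all_ages_entering
    (hKL : ∀ i m l, 0 ≤ KL i m l) (hKLN : ∀ i m l, N ≤ l → KL i m l = 0) (hKLy : ∀ i m l, y i ≤ l → KL i m l = 0)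
    (hRL : ∀ i v m, RL i v m = ∑ l ∈ range N, KL i m l * v (m + 1 + l))
    (hRA : ∀ i v m, RA i v m = ∑ l ∈ range N, KA i m l * v (m + 1 + l))
    (hKA : ∀ i m l, KA i m l = KL i m l + KA (i + 1) m l) (hKAtop : ∀ m l, KA (n + 1) m l = 0)
    (hSL : ∀ i (w : ℕ → ℝ), (∀ m, N < m → w m = 0) → (∀ m, N < m → SL i w m = 0) ∧ ∀ m, SL i w m = w m - RL i (SL i w) m)
    (hSA : ∀ i (w : ℕ → ℝ), (∀ m, N < m → w m = 0) → (∀ m, N < m → SA i w m = 0) ∧ ∀ m, SA i w m = w m - RA i (SA i w) m)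
    (hy : ∀ i, 1 ≤ i → i ≤ n → 1 ≤ y i ∧ y i ≤ N)
    (hθ0 : ∀ k m l, 0 ≤ θ k m l) (hpers : ∀ k m l i', (1 - θ k m l) * KL k m (i' + l) ≤ KL k (m + l) i')
    (hθmono : ∀ k m l l', l ≤ l' → θ k m l ≤ θ k m l')
    {ρ : ℕ → ℕ → ℝ} {β : ℕ → ℕ → ℕ → ℝ}
    (hρ : ∀ i m, 1 ≤ i → i ≤ n → ρ i m = (∑ l ∈ range N, KL i m l) * (1 + ∑ k ∈ Ioc i n, θ k m (y i) * β (i + 1) m k) /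
      (1 - ∑ k ∈ Ioc i n, ∑ l ∈ range (y i), KL k m l))
    (hβnew : ∀ i m, 1 ≤ i → i ≤ n → β i m i = ρ i m / (1 - ρ i m))
    (hβold : ∀ i m k, 1 ≤ i → i < k → k ≤ n → β i m k = β (i + 1) m k / (1 - ρ i m))
    (hΩ1 : ∀ i m, 1 ≤ i → i ≤ n → ∑ k ∈ Ioc i n, ∑ l ∈ range (y i), KL k m l < 1)
    (hclose : ∀ i m, 1 ≤ i → i ≤ n → ρ i m < 1)
    (hshift : ∀ k m l, l + 1 < y k → KL k (m + 1) l ≤ KL k m (l + 1))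
    (hΩ0 : ∀ i m, i ≤ n → ∑ k ∈ Ioc i n, KL k m 0 < 1)
    {Hg : ℕ → ℕ → ℝ} (hH : ∀ i m, Hg i m = (1 + ∑ k ∈ Ioc i n, θ k m 1 * β (i + 1) m k) / (1 - ∑ k ∈ Ioc i n, KL k m 0))
    {σ : ℕ → ℕ → ℝ} (hσ1 : ∀ k m l, l + 1 < y k → KL k (m + 1) l = σ k m * KL k m (l + 1)) (hσ01 : ∀ k m, 0 ≤ σ k m ∧ σ k m ≤ 1)
    {AL : ℕ → ℕ → ℕ → ℝ} (hAL : ∀ i j p, AL i j p = ∑ l ∈ range (y i), if p + 1 + l ≤ j then KL i p l * (1 - ρ i (p + 1 + l)) else 0)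
    {P : ℕ → Prop}
    (hMONOopt : ∀ i k, 1 ≤ i → i < k → k ≤ n →
      (∀ m L, ∑ l ∈ range (L + 1), KL k (m + 1) l ≤ ∑ l ∈ range (L + 2), KL k m l) ∨ (∀ m l, KL i m l = 0) ∨
      (y i = 1 ∧ ∀ m, KL k (m + 1) (y k - 1) * KL i (m + 1 + y k) 0 * ∏ p ∈ Ico (m + 2) (m + 2 + y k), Hg i p ≤
        KL k m 0 * KL i (m + 1) 0 * (1 - KL i (m + 2) 0 * Hg i (m + 2))) ∨
      (P (i + 1) ∧ ∀ j m, m + 1 + y k ≤ j →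
        KL k (m + 1) (y k - 1) * ∑ l ∈ range (y i), KL i (m + 1 + y k) l * ∏ s ∈ Ico (m + 2) (m + 2 + y k + l), Hg i s ≤
          (1 - σ k m) * ∑ l' ∈ range (y k), KL k m l' * AL i j (m + 1 + l') + σ k m * (KL k m 0 * AL i j (m + 1))))
    {M : ℕ → ℕ → ℝ} (hM : ∀ i m, M i m = KL i m 0 + ∑ l ∈ range (N - 1), max (KL i m (l + 1) - KL i (m + 1) l) 0)
    {HgS : ℕ → ℕ → ℕ → ℝ} (hHS : ∀ i j m, HgS i j m = (1 + ∑ k ∈ Ioc i n, θ k m 1 * β (i + 1) m k) /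
      (1 - ∑ k ∈ Ioc i n, (KL k m 0 - if m + 1 + y k ≤ j then KL k (m + 1) (y k - 1) else 0)))
    (hlev : ∀ i, 1 ≤ i → i < n →
      (y i = 1 ∧ ∀ m, (1 + M i m) * (Hg i (m + 1) * KL i (m + 1) 0) ≤ KL i m 0) ∨ (∀ m l, KL i m l = 0) ∨
      (P (i + 1) ∧ (∀ m L', L' < y i → (1 + M i m) * ∑ l ∈ Ico L' (y i), Hg i (m + 1 + l) * KL i (m + 1) l ≤ ∑ l ∈ Ico L' (y i), KL i m l) ∧
        (∀ m L, L < y i → ∀ L', L' ≤ L → (1 + M i m) * ∑ l ∈ Ico L' L, Hg i (m + 1 + l) * KL i (m + 1) l ≤ ∑ l ∈ Ico L' (L + 1), KL i m l)) ∨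
      (P (i + 1) ∧ ∀ m, KL i (m + 1) (y i - 1) * ∏ p ∈ Ico (m + 1) (m + 1 + y i), Hg i p ≤
        (1 - σ i m) * ∑ l ∈ range (y i), KL i m l * (1 - ρ i (m + 1 + l)) + σ i m * (KL i m 0 * (1 - ρ i (m + 1)))))
    (hSc : ∀ i m j, 1 ≤ i → i ≤ n → P i → m + 1 + N ≤ j → ∀ L', L' < N →
      ∑ l ∈ Ico L' N, HgS (i - 1) j (m + 1 + l) * KA i (m + 1) l ≤ ∑ l ∈ Ico L' N, KA i m l)
    (hScp : ∀ i m L, 1 ≤ i → i ≤ n → P i → L < N → ∀ L', L' ≤ L →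
      ∑ l ∈ Ico L' L, HgS (i - 1) (m + 1 + L) (m + 1 + l) * KA i (m + 1) l ≤ ∑ l ∈ Ico L' (L + 1), KA i m l) :
    ∀ i, 1 ≤ i → i ≤ n + 1 →
      (∀ m k, i ≤ k → k ≤ n → 0 ≤ β i m k) ∧
      (∀ w : ℕ → ℝ, (∀ m, 0 ≤ w m) → (∀ m, w (m + 1) ≤ w m) → (∀ m, N < m → w m = 0) →
        (∀ m, 0 ≤ SA i w m) ∧ (∀ m k, i ≤ k → k ≤ n → RL k (SA i w) m ≤ β i m k * SA i w m)) ∧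
      (P i → ∀ j, j ≤ N → ∀ m, m < j → SA i (fun m => if m ≤ j then (1:ℝ) else 0) m ≤ SA i (fun m => if m ≤ j then (1:ℝ) else 0) (m + 1)) := by
  suffices h : ∀ d i, i + d = n + 1 → 1 ≤ i →
      (∀ m k, i ≤ k → k ≤ n → 0 ≤ β i m k) ∧
      (∀ w : ℕ → ℝ, (∀ m, 0 ≤ w m) → (∀ m, w (m + 1) ≤ w m) → (∀ m, N < m → w m = 0) →
        (∀ m, 0 ≤ SA i w m) ∧ (∀ m k, i ≤ k → k ≤ n → RL k (SA i w) m ≤ β i m k * SA i w m)) ∧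
      (P i → ∀ j, j ≤ N → ∀ m, m < j → SA i (fun m => if m ≤ j then (1:ℝ) else 0) m ≤ SA i (fun m => if m ≤ j then (1:ℝ) else 0) (m + 1)) from
    fun i hi hin => h (n + 1 - i) i (by omega) hi
  -- the support of the surplus of a truncation, and the per-pin growth from drop ratios (both levels)
  have hsupp : ∀ i j, j ≤ N → ∀ m, j < m → SA i (fun m => if m ≤ j then (1:ℝ) else 0) m = 0 := by
    intro i j hj m hm
    have het := (truncation_admissible (N := N) hj).2.2
    exact sol_eq_zero_of_tail (hRA i) (hSA i _ het).1 (hSA i _ het).2 (c := N - j)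
      (fun m' hm' => by exact if_neg (by omega)) m (by omega)
  have hN1 : 1 ≤ n → 1 ≤ N := fun hn => (hy 1 le_rfl hn).2.trans' (hy 1 le_rfl hn).1
  intro d
  induction d with
  | zero =>
    intro i hi _
    have : i = n + 1 := by omega
    subst this
    refine ⟨fun m k hk hkn => by omega, fun w hw0 _ hwt => ⟨fun m => ?_, fun m k hk hkn => by omega⟩, fun _ j hj m hmj => ?_⟩
    · rw [aggregate_sol_top hRA hKAtop hSA hwt m]; exact hw0 m
    · have het := (truncation_admissible (N := N) hj).2.2
      rw [aggregate_sol_top hRA hKAtop hSA het m, aggregate_sol_top hRA hKAtop hSA het (m + 1)]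
      rw [if_pos (by omega), if_pos (by omega)]
  | succ d ih =>
    intro i hi hi1
    have hin : i ≤ n := by omega
    obtain ⟨hBN, hIH, hM1⟩ := ih (i + 1) (by omega) (by omega)
    obtain ⟨hy1, hyN⟩ := hy i hi1 hin
    have hx0 : ∀ m, 0 ≤ ∑ l ∈ range N, KL i m l := fun m => sum_nonneg fun l _ => hKL i m l
    have hV0 : ∀ m, 0 ≤ ∑ k ∈ Ioc i n, θ k m (y i) * β (i + 1) m k := fun m =>
      sum_nonneg fun k hk => mul_nonneg (hθ0 k m _) (hBN m k (by have := (mem_Ioc.mp hk).1; omega) (mem_Ioc.mp hk).2)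
    have hρ0 : ∀ m, 0 ≤ ρ i m := fun m => by
      rw [hρ i m hi1 hin]
      exact div_nonneg (mul_nonneg (hx0 m) (by linarith [hV0 m])) (by linarith [hΩ1 i m hi1 hin])
    have hρ1 : ∀ m, ρ i m < 1 := fun m => hclose i m hi1 hin
    -- (A) KEY_i WITH THE RATIO ρ_i(m)
    have hkey : ∀ w : ℕ → ℝ, (∀ m, 0 ≤ w m) → (∀ m, w (m + 1) ≤ w m) → (∀ m, N < m → w m = 0) →
        ∀ m, RL i (SA (i + 1) w) m ≤ ρ i m * SA (i + 1) w m := by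
      intro w hw0 hwa hwt m
      obtain ⟨hP, hDR⟩ := hIH w hw0 hwa hwt
      have h := (key_ratio_of_drop_ratios hKL hKLN hKLy hRL hRA hKA hKAtop hθ0 hpers hθmono hin hy1 hyN hP hwa
        (fun m' => (hSA (i + 1) w hwt).2 m') (m := m) (β := fun k => β (i + 1) m k)
        (fun k hk hkn => hDR m k (by omega) hkn) (hΩ1 i m hi1 hin)).2
      rw [hρ i m hi1 hin]
      exact h
    have hKEY : ∀ w : ℕ → ℝ, (∀ m, 0 ≤ w m) → (∀ m, w (m + 1) ≤ w m) → (∀ m, N < m → w m = 0) →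
        ∀ m, RL i (SA (i + 1) w) m ≤ SA (i + 1) w m := by
      intro w hw0 hwa hwt m
      have h1 := hkey w hw0 hwa hwt m
      have h2 := (hIH w hw0 hwa hwt).1 m
      nlinarith [hρ1 m]
    -- the old aggregate kernel: signs, horizon, cumulative domination
    have hKA0 : ∀ m l, 0 ≤ KA (i + 1) m l := fun m l => by
      rw [aggregate_eq_sum hKA hKAtop (by omega : i + 1 ≤ n + 1)]
      exact sum_nonneg fun k _ => hKL k m l
    have hKAN : ∀ m l, N ≤ l → KA (i + 1) m l = 0 := fun m l hl => by
      rw [aggregate_eq_sum hKA hKAtop (by omega : i + 1 ≤ n + 1)]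
      exact sum_eq_zero fun k _ => hKLN k m l hl
    -- the per-pin growth of the old surplus (level i+1) from its drop ratios
    have hΩ0i := fun m => hΩ0 i m hin
    have hgrow : ∀ w : ℕ → ℝ, (∀ m, 0 ≤ w m) → (∀ m, w (m + 1) ≤ w m) → (∀ m, N < m → w m = 0) →
        ∀ m, SA (i + 1) w (m + 1) ≤ Hg i m * SA (i + 1) w m := by
      intro w hw0 hwa hwt m
      obtain ⟨hP, hDR⟩ := hIH w hw0 hwa hwt
      have h := per_pin_growth_of_drop_ratios hKL hKLN (hN1 (by omega)) hRL hRA hKA hKAtop hθ0 hpers hin hP hwa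
        (fun m' => (hSA (i + 1) w hwt).2 m') (m := m) (β := fun k => β (i + 1) m k) (fun k hk hkn => hDR m k (by omega) hkn)
      rw [hH, div_mul_eq_mul_div, le_div_iff₀ (by linarith [hΩ0i m])]
      linarith
    have hHg0 : ∀ m, 0 ≤ Hg i m := fun m => by
      have hV : 0 ≤ ∑ k ∈ Ioc i n, θ k m 1 * β (i + 1) m k := sum_nonneg fun k hk =>
        mul_nonneg (hθ0 k m 1) (hBN m k (by have := (mem_Ioc.mp hk).1; omega) (mem_Ioc.mp hk).2)
      rw [hH]; exact div_nonneg (by linarith) (by linarith [hΩ0 i m hin])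
    -- (B) MONO″_i: for truncations from (M1)_{i+1}, growth and (S-b) — OR from the entering-lag family (S-e); for all admissible inputs by linearity
    have hM0 : ∀ m, 0 ≤ M i m := fun m => by rw [hM]; exact add_nonneg (hKL i m 0) (sum_nonneg fun l _ => le_max_right _ _)
    have hMONO2 : i < n → ∀ w : ℕ → ℝ, (∀ m, 0 ≤ w m) → (∀ m, w (m + 1) ≤ w m) → (∀ m, N < m → w m = 0) →
        ∀ m, RL i (SL i (SA (i + 1) w)) (m + 1) ≤ RL i (SL i (SA (i + 1) w)) m := by
      intro hlt w hw0 hwa hwt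
      -- linearity of the composite w ↦ RL i (SL i (SA (i+1) w))
      have hlin : ∀ (s : Finset ℕ) (a : ℕ → ℝ) (u : ℕ → ℕ → ℝ), (∀ j ∈ s, ∀ m, N < m → u j m = 0) →
          ∀ m, (fun (w : ℕ → ℝ) m => RL i (SL i (SA (i + 1) w)) m) (fun m => ∑ j ∈ s, a j * u j m) m =
            ∑ j ∈ s, a j * (fun (w : ℕ → ℝ) m => RL i (SL i (SA (i + 1) w)) m) (u j) m := by
        intro s a u hu m
        have e1 : SA (i + 1) (fun m => ∑ j ∈ s, a j * u j m) = fun m => ∑ j ∈ s, a j * SA (i + 1) (u j) m :=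
          funext (sol_lincomb (hRA (i + 1)) (hSA (i + 1)) s a hu)
        have hu' : ∀ j ∈ s, ∀ m, N < m → SA (i + 1) (u j) m = 0 := fun j hj => (hSA (i + 1) (u j) (hu j hj)).1
        have e2 : SL i (fun m => ∑ j ∈ s, a j * SA (i + 1) (u j) m) = fun m => ∑ j ∈ s, a j * SL i (SA (i + 1) (u j)) m :=
          funext (sol_lincomb (hRL i) (hSL i) s a hu')
        beta_reduce
        rw [e1, e2, read_lincomb (hRL i)]
      -- truncations: (E81f) read decay + (E81a)
      have htr : ∀ j, j ≤ N → ∀ m, (fun (w : ℕ → ℝ) m => RL i (SL i (SA (i + 1) w)) m) (fun m => if m ≤ j then (1:ℝ) else 0) (m + 1) ≤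
          (fun (w : ℕ → ℝ) m => RL i (SL i (SA (i + 1) w)) m) (fun m => if m ≤ j then (1:ℝ) else 0) m := by
        intro j hj m
        beta_reduce
        obtain ⟨he0, hea, het⟩ := truncation_admissible (N := N) hj
        have hvt := (hSA (i + 1) _ het).1
        have hv0 := (hIH _ he0 hea het).1
        have htv := sol_nonneg_le_of_supersol (hRL i) (hKL i) hv0 (hKEY _ he0 hea het) (hSL i _ hvt).1 (hSL i _ hvt).2
        rcases hlev i hi1 hlt with ⟨hone, hSb0⟩ | hzero | ⟨hP, hSb, hSbp⟩ | ⟨hP, hSe⟩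
        · -- a ONE-LAG age: growth and (S-b) at `L' = 0` give the read decay (no monotonicity of the older surplus)
          have hcrit : ∀ n', M i n' * RL i (SA (i + 1) (fun m => if m ≤ j then (1:ℝ) else 0)) (n' + 1) ≤
              RL i (SA (i + 1) (fun m => if m ≤ j then (1:ℝ) else 0)) n' - RL i (SA (i + 1) (fun m => if m ≤ j then (1:ℝ) else 0)) (n' + 1) :=
            fun n' => read_decay_one_lag (hRL i) (hKL i) (fun m l hl => hKLy i m l (by omega)) (by omega) hv0
              (H := Hg i) (fun m => hgrow _ he0 hea het m) (hM0 n') (hSb0 n')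
          exact young_drops_antitone_of_read_decay hRL hKL hSL (hM i) hv0 hvt (hKEY _ he0 hea het)
            (fun m => (drops_mem (hRL i) (hKL i) htv m).2) hcrit m
        · -- a SILENT age: zero kernel, zero drops
          rw [hRL, hRL, sum_eq_zero fun l _ => by rw [hzero, zero_mul], sum_eq_zero fun l _ => by rw [hzero, zero_mul]]
        · -- a window of several lags: (E81f) read decay from the static tail sums (S-b) and (M1)_{i+1}
          have hcrit : ∀ n', M i n' * RL i (SA (i + 1) (fun m => if m ≤ j then (1:ℝ) else 0)) (n' + 1) ≤
              RL i (SA (i + 1) (fun m => if m ≤ j then (1:ℝ) else 0)) n' - RL i (SA (i + 1) (fun m => if m ≤ j then (1:ℝ) else 0)) (n' + 1) :=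
            fun n' => read_decay_of_tail_sums (hRL i) (hKL i) (fun m l hl => hKLy i m l hl) hy1 hyN hv0 (hsupp (i + 1) j hj) (hM1 hP j hj)
              (H := Hg i) (fun m _ => hgrow _ he0 hea het m) (hM0 n')
              (fun _ L' hL' => hSb n' L' hL') (fun L _ hLy L' hL' => hSbp n' L hLy L' hL')
          exact young_drops_antitone_of_read_decay hRL hKL hSL (hM i) hv0 hvt (hKEY _ he0 hea het)
            (fun m => (drops_mem (hRL i) (hKL i) htv m).2) hcrit m
        · -- a window of several lags: MONO″ DIRECTLY from the entering-lag identity and the static family (S-e) ((E86c) `mono2_of_entering`)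
          exact mono2_of_entering (hRL i) (hKL i) (hKLy i) hy1 hyN (hσ1 i) (hσ01 i) hv0 (hsupp (i + 1) j hj) (hM1 hP j hj)
            (H := Hg i) hHg0 (hgrow _ he0 hea het) (ρ := ρ i) (hkey _ he0 hea het) (fun m => (hρ1 m).le)
            (hSL i _ hvt).1 (hSL i _ hvt).2 (fun m _ => hSe m) m
      exact antitone_of_truncations (D := fun (w : ℕ → ℝ) m => RL i (SL i (SA (i + 1) w)) m) hlin htr hwa hwt
    -- MONO_i in full (signs from KEY_i, MONOa from (S-a)) and MONO′_i through the Neumann terms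
    have hMONO : i < n → ∀ w : ℕ → ℝ, (∀ m, 0 ≤ w m) → (∀ m, w (m + 1) ≤ w m) → (∀ m, N < m → w m = 0) →
        (∀ m, 0 ≤ RA (i + 1) (RL i (SL i (SA (i + 1) w))) m) ∧
        (∀ m, RA (i + 1) (RL i (SL i (SA (i + 1) w))) (m + 1) ≤ RA (i + 1) (RL i (SL i (SA (i + 1) w))) m) := by
      intro hlt w hw0 hwa hwt
      have hvt := (hSA (i + 1) w hwt).1; have hv0 := (hIH w hw0 hwa hwt).1
      have ht := sol_nonneg_le_of_supersol (hRL i) (hKL i) hv0 (hKEY w hw0 hwa hwt) (hSL i _ hvt).1 (hSL i _ hvt).2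
      have hd0 : ∀ m, 0 ≤ RL i (SL i (SA (i + 1) w)) m := fun m => read_nonneg (hRL i) (hKL i) (fun m' _ => (ht m').1)
      have hsplit : ∀ (u : ℕ → ℝ) m, RA (i + 1) u m = ∑ k ∈ Ico (i + 1) (n + 1), RL k u m := fun u m => by
        rw [hRA, sum_congr rfl fun l _ => by rw [aggregate_eq_sum hKA hKAtop (show i + 1 ≤ n + 1 by omega), sum_mul], sum_comm]
        exact sum_congr rfl fun k _ => (hRL k u m).symm
      refine ⟨fun m => read_nonneg (hRA (i + 1)) hKA0 (fun m' _ => hd0 m'), fun m => ?_⟩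
      rw [hsplit, hsplit]; refine sum_le_sum fun k hk => ?_; obtain ⟨hik, hkn⟩ := mem_Ico.mp hk
      have hgen : ∀ u : ℕ → ℝ, (∀ m, 0 ≤ u m) → (∀ m, u (m + 1) ≤ u m) → (∀ m, N < m → u m = 0) →
          ((∀ m' L, ∑ l ∈ range (L + 1), KL k (m' + 1) l ≤ ∑ l ∈ range (L + 2), KL k m' l) ∨ (∀ m' l, KL i m' l = 0) ∨
            (y i = 1 ∧ ∀ m', KL k (m' + 1) (y k - 1) * KL i (m' + 1 + y k) 0 * ∏ p ∈ Ico (m' + 2) (m' + 2 + y k), Hg i p ≤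
              KL k m' 0 * KL i (m' + 1) 0 * (1 - KL i (m' + 2) 0 * Hg i (m' + 2)))) →
          ∀ m', RL k (RL i (SL i (SA (i + 1) u))) (m' + 1) ≤ RL k (RL i (SL i (SA (i + 1) u))) m' := by
        intro u hu0 hua hut hopt m'
        have hut' := (hSA (i + 1) u hut).1; have hu0' := (hIH u hu0 hua hut).1
        have htu := sol_nonneg_le_of_supersol (hRL i) (hKL i) hu0' (hKEY u hu0 hua hut) (hSL i _ hut').1 (hSL i _ hut').2
        have hdu0 : ∀ m, 0 ≤ RL i (SL i (SA (i + 1) u)) m := fun m => read_nonneg (hRL i) (hKL i) (fun m' _ => (htu m').1)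
        rcases hopt with hcum | hzero | ⟨hone, hsd⟩
        · exact read_antitone_of_cum_dom (hRL k) (hKL k) (hKLN k) hcum hdu0 (hMONO2 hlt u hu0 hua hut) m'
        · have hz : ∀ m', RL i (SL i (SA (i + 1) u)) m' = 0 := fun m' => by rw [hRL, sum_eq_zero fun l _ => by rw [hzero, zero_mul]]
          rw [hRL k, hRL k, sum_eq_zero fun l _ => by rw [hz, mul_zero], sum_eq_zero fun l _ => by rw [hz, mul_zero]]
        · obtain ⟨hyk1, hykN⟩ := hy k (by omega) (by omega)
          exact old_read_antitone_of_static_decay hRL hKL (hN1 (by omega)) (fun m' l hl => hKLy i m' l (by omega)) (hKLy k) hyk1 hykN (hshift k)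
            hu0' (hKEY u hu0 hua hut) (hSL i _ hut').1 (hSL i _ hut').2 hHg0 (hgrow u hu0 hua hut) (hsd m')
      rcases hMONOopt i k hi1 (by omega) (by omega) with hcum | hzero | hsd | ⟨hP, hSh⟩
      · exact hgen w hw0 hwa hwt (Or.inl hcum) m
      · exact hgen w hw0 hwa hwt (Or.inr (Or.inl hzero)) m
      · exact hgen w hw0 hwa hwt (Or.inr (Or.inr hsd)) m
      · have hlin2 : ∀ (s : Finset ℕ) (a : ℕ → ℝ) (u : ℕ → ℕ → ℝ), (∀ j ∈ s, ∀ m, N < m → u j m = 0) →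
            ∀ m, (fun (w : ℕ → ℝ) m => RL k (RL i (SL i (SA (i + 1) w))) m) (fun m => ∑ j ∈ s, a j * u j m) m =
              ∑ j ∈ s, a j * (fun (w : ℕ → ℝ) m => RL k (RL i (SL i (SA (i + 1) w))) m) (u j) m := by
          intro s a u hu m
          have e1 : SA (i + 1) (fun m => ∑ j ∈ s, a j * u j m) = fun m => ∑ j ∈ s, a j * SA (i + 1) (u j) m :=
            funext (sol_lincomb (hRA (i + 1)) (hSA (i + 1)) s a hu)
          have hu' : ∀ j ∈ s, ∀ m, N < m → SA (i + 1) (u j) m = 0 := fun j hj => (hSA (i + 1) (u j) (hu j hj)).1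
          have e2 : SL i (fun m => ∑ j ∈ s, a j * SA (i + 1) (u j) m) = fun m => ∑ j ∈ s, a j * SL i (SA (i + 1) (u j)) m :=
            funext (sol_lincomb (hRL i) (hSL i) s a hu')
          have e3 : RL i (fun m => ∑ j ∈ s, a j * SL i (SA (i + 1) (u j)) m) = fun m => ∑ j ∈ s, a j * RL i (SL i (SA (i + 1) (u j))) m :=
            funext (read_lincomb (hRL i) s a _)
          beta_reduce
          rw [e1, e2, e3, read_lincomb (hRL k)]
        have htr2 : ∀ j, j ≤ N → ∀ m, (fun (w : ℕ → ℝ) m => RL k (RL i (SL i (SA (i + 1) w))) m) (fun m => if m ≤ j then (1:ℝ) else 0) (m + 1) ≤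
            (fun (w : ℕ → ℝ) m => RL k (RL i (SL i (SA (i + 1) w))) m) (fun m => if m ≤ j then (1:ℝ) else 0) m := by
          intro j hj m
          beta_reduce
          obtain ⟨he0, hea, het⟩ := truncation_admissible (N := N) hj
          have hvt' := (hSA (i + 1) _ het).1
          have hv0' := (hIH _ he0 hea het).1
          obtain ⟨hyk1, hykN⟩ := hy k (by omega) (by omega)
          exact old_read_antitone_of_decay_defect (hRL i) (hKL i) (hKLy i) hyN (hRL k) (hKL k) (hKLy k) hyk1 hykN (hσ1 k) (hσ01 k)
            hv0' (hsupp (i + 1) j hj) (hM1 hP j hj) (H := Hg i) hHg0 (hgrow _ he0 hea het) (ρ := ρ i) (hkey _ he0 hea het)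
            (fun m => (hρ1 m).le) (hSL i _ hvt').1 (hSL i _ hvt').2 (A := AL i j) (hAL i j) (fun m hm => hSh j m hm) m
        exact antitone_of_truncations (D := fun (w : ℕ → ℝ) m => RL k (RL i (SL i (SA (i + 1) w))) m) hlin2 htr2 hwa hwt m
    have hMONO' : i < n → ∀ w : ℕ → ℝ, (∀ m, 0 ≤ w m) → (∀ m, w (m + 1) ≤ w m) → (∀ m, N < m → w m = 0) →
        ∀ m, RL i (SA i w) (m + 1) ≤ RL i (SA i w) m := by
      intro hlt w hw0 hwa hwt
      have hwrec : ∀ m, SA i w m = w m - RA (i + 1) (SA i w) m - RL i (SA i w) m := fun m => by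
        rw [(hSA i w hwt).2 m, aggregate_read_succ hRL hRA hKA]; ring
      exact antitone_young_drops (RO := RA (i + 1)) (Ry := RL i) (SO := SA (i + 1)) (Sy := SL i)
        (hRA (i + 1)) (hRL i) (hSA (i + 1)) (hSL i) (hMONO hlt) (hMONO2 hlt) hw0 hwa hwt (hSA i w hwt).1 hwrec
    -- (i) the carried ratios stay non-negative
    have hB : ∀ m k, i ≤ k → k ≤ n → 0 ≤ β i m k := by
      intro m k hk hkn
      rcases Nat.lt_or_ge i k with hik | hik
      · rw [hβold i m k hi1 hik hkn]
        exact div_nonneg (hBN m k (by omega) hkn) (by linarith [hρ1 m])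
      · have : k = i := by omega
        subst this
        rw [hβnew k m hi1 hin]
        exact div_nonneg (hρ0 m) (by linarith [hρ1 m])
    -- (ii) positivity and drop ratios for every admissible input
    have hmain : ∀ e : ℕ → ℝ, (∀ m, 0 ≤ e m) → (∀ m, e (m + 1) ≤ e m) → (∀ m, N < m → e m = 0) →
        (∀ m, 0 ≤ SA i e m) ∧ (∀ m k, i ≤ k → k ≤ n → RL k (SA i e) m ≤ β i m k * SA i e m) := by
      intro e he0 hea het
      have hεrec : ∀ m, SA i e m = e m - RA (i + 1) (SA i e) m - RL i (SA i e) m := fun m => by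
        rw [(hSA i e het).2 m, aggregate_read_succ hRL hRA hKA]; ring
      -- positivity and the sandwich: by composition below the top, DIRECTLY at the top
      have hcore : (∀ m, 0 ≤ SA i e m) ∧ ∀ m, (1 - ρ i m) * SA (i + 1) e m ≤ SA i e m ∧ SA i e m ≤ SA (i + 1) e m := by
        rcases Nat.lt_or_ge i n with hlt | hge
        · have hcomp := nonneg_of_age_composition_antitone (RO := RA (i + 1)) (Ry := RL i) (SO := SA (i + 1)) (Sy := SL i)
            (hRA (i + 1)) (hRL i) (hKL i) (hSA (i + 1)) (hSL i)
            (fun u hu0 hua hut => ⟨(hIH u hu0 hua hut).1, hKEY u hu0 hua hut, hMONO hlt u hu0 hua hut⟩)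
            he0 hea het (hSA i e het).1 hεrec
          have hε0 : ∀ m, 0 ≤ SA i e m := fun m => (hcomp m).1
          have hsand := surplus_sandwich (RO := RA (i + 1)) (Ry := RL i) (SO := SA (i + 1)) (Sy := SL i)
            (A := fun w => (∀ m, 0 ≤ w m) ∧ ∀ m, w (m + 1) ≤ w m)
            (hRA (i + 1)) (hRL i) (hKL i) (hSA (i + 1)) (hSL i) het ⟨he0, hea⟩
            (fun u hu hut => ⟨(hIH u hu.1 hu.2 hut).1, hKEY u hu.1 hu.2 hut, hMONO hlt u hu.1 hu.2 hut⟩)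
            (hSA i e het).1 hεrec (ρ := ρ i) (hkey e he0 hea het)
            ⟨fun m => read_nonneg (hRL i) (hKL i) (fun m' _ => hε0 m') , hMONO' hlt e he0 hea het⟩
          exact ⟨hε0, hsand⟩
        · -- THE OLDEST AGE: the old system is empty; a lone age with KEY needs no monotonicity of its drops
          have hin' : i = n := le_antisymm hin hge
          have hveqf : SA (i + 1) e = e := funext fun m => by rw [hin']; exact aggregate_sol_top hRA hKAtop hSA het m
          have hRA0 : ∀ m, RA (i + 1) (SA i e) m = 0 := fun m => by
            rw [hRA, sum_eq_zero fun l _ => by rw [hin', hKAtop, zero_mul]]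
          have hrec' : ∀ m, SA i e m = e m - RL i (SA i e) m := fun m => by rw [hεrec m, hRA0 m, sub_zero]
          have hkeye : ∀ m, RL i e m ≤ e m := fun m => by have h := hKEY e he0 hea het m; rwa [hveqf] at h
          have hkeyρ : ∀ m, RL i e m ≤ ρ i m * e m := fun m => by have h := hkey e he0 hea het m; rwa [hveqf] at h
          have htv := sol_nonneg_le_of_supersol (hRL i) (hKL i) he0 hkeye (hSA i e het).1 hrec'
          refine ⟨fun m => (htv m).1, fun m => ⟨?_, ?_⟩⟩
          · rw [hveqf]
            have h1 := read_le_read (hRL i) (hKL i) (t := SA i e) (v := e) (n := m) fun m' _ => (htv m').2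
            linarith [hrec' m, hkeyρ m]
          · rw [hveqf]; exact (htv m).2
      obtain ⟨hε0, hsand⟩ := hcore
      obtain ⟨_, hDRv⟩ := hIH e he0 hea het
      refine ⟨hε0, fun m k hk hkn => ?_⟩
      have hle : ∀ m', SA i e m' ≤ SA (i + 1) e m' := fun m' => (hsand m').2
      have hlow : (1 - ρ i m) * SA (i + 1) e m ≤ SA i e m := (hsand m).1
      rcases Nat.lt_or_ge i k with hik | hik
      · rw [hβold i m k hi1 hik hkn]
        exact drop_ratio_step (D := fun u => RL k u m)
          (fun u u' hu0 huu' => read_le_read (hRL k) (hKL k) fun m' _ => huu' m')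
          hε0 hle hlow (hρ1 m) (hBN m k (by omega) hkn) (hDRv m k (by omega) hkn)
      · have : k = i := by omega
        subst this
        rw [hβnew k m hi1 hin]
        exact drop_ratio_step (D := fun u => RL k u m)
          (fun u u' hu0 huu' => read_le_read (hRL k) (hKL k) fun m' _ => huu' m')
          hε0 hle hlow (hρ1 m) (hρ0 m) (hkey e he0 hea het m)
    refine ⟨hB, hmain, fun hPi j hj => ?_⟩
    -- (iii) (M1)_i by a downward induction in the pin, from (S-c) and the growth of the level-i surplus
    obtain ⟨he0, hea, het⟩ := truncation_admissible (N := N) hj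
    set e : ℕ → ℝ := fun m => if m ≤ j then (1:ℝ) else 0 with he
    obtain ⟨hε0, hDR⟩ := hmain e he0 hea het
    have hεt := (hSA i e het).1
    have hεj := hsupp i j hj
    have hKAi0 : ∀ m l, 0 ≤ KA i m l := fun m l => by
      rw [aggregate_eq_sum hKA hKAtop (by omega : i ≤ n + 1)]; exact sum_nonneg fun k _ => hKL k m l
    have hKAiN : ∀ m l, N ≤ l → KA i m l = 0 := fun m l hl => by
      rw [aggregate_eq_sum hKA hKAtop (by omega : i ≤ n + 1)]; exact sum_eq_zero fun k _ => hKLN k m l hl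
    -- growth of ε = SA i e from its own drop ratios, SHARP (entering lags below the edge credited); needs ε monotone deeper (downward IH)
    have hi' : i - 1 + 1 = i := by omega
    have hgrowε : ∀ m', (∀ p, m' + 1 ≤ p → p < j → SA i e p ≤ SA i e (p + 1)) → SA i e (m' + 1) ≤ HgS (i - 1) j m' * SA i e m' := by
      intro m' hmon
      -- monotone chains on [m'+1, j]
      have hchain : ∀ q a, m' + 1 ≤ a → a + q ≤ j → SA i e a ≤ SA i e (a + q) := by
        intro q
        induction q with
        | zero => intro a _ _; simp
        | succ q ihq => intro a ha hq; exact (ihq a ha (by omega)).trans (by rw [← add_assoc]; exact hmon (a + q) (by omega) (by omega))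
      have h := per_pin_growth_sharp hKL hKLN hKLy (fun k hk hkn => hy k (by omega) hkn) hRL hRA hKA hKAtop hθ0 hpers (i := i - 1) (by omega) hε0 hea
        (fun p => by rw [hi']; exact (hSA i e het).2 p) (m := m') (β := fun k => β i m' k) (fun k hk hkn => hDR m' k (by omega) hkn)
        (s := fun k => if m' + 1 + y k ≤ j then (1:ℝ) else 0) (fun k hk hkn => by
          split_ifs with hjk
          · rw [one_mul]; exact mul_le_mul_of_nonneg_left (hchain (y k) (m' + 1) le_rfl (by omega)) (hKL k _ _)
          · rw [zero_mul, zero_mul]; exact mul_nonneg (hKL k _ _) (hε0 _))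
      have hΩ := hΩ0 (i - 1) m' (by omega)
      have hden : 0 < 1 - ∑ k ∈ Ioc (i - 1) n, (KL k m' 0 - if m' + 1 + y k ≤ j then KL k (m' + 1) (y k - 1) else 0) := by
        have : ∑ k ∈ Ioc (i - 1) n, (KL k m' 0 - if m' + 1 + y k ≤ j then KL k (m' + 1) (y k - 1) else 0) ≤ ∑ k ∈ Ioc (i - 1) n, KL k m' 0 :=
          sum_le_sum fun k _ => by split_ifs <;> linarith [hKL k (m' + 1) (y k - 1)]
        linarith
      have e1 : ∀ k ∈ Ioc (i - 1) n, (KL k m' 0 - (if m' + 1 + y k ≤ j then (1:ℝ) else 0) * KL k (m' + 1) (y k - 1)) =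
          (KL k m' 0 - if m' + 1 + y k ≤ j then KL k (m' + 1) (y k - 1) else 0) := fun k _ => by split_ifs <;> ring
      rw [sum_congr rfl e1] at h
      rw [hHS, hi', div_mul_eq_mul_div, le_div_iff₀ hden]
      linarith
    -- downward induction in the pin
    suffices hdown : ∀ dd m, j ≤ m + dd → m < j → SA i e m ≤ SA i e (m + 1) from fun m hm => hdown j m (by omega) hm
    intro dd
    induction dd with
    | zero => intro m hm hmj; omega
    | succ dd ihd =>
      intro m hm hmj
      have hreads : (1:ℝ) * RA i (SA i e) (m + 1) ≤ RA i (SA i e) m :=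
        scaled_read_le_of_tail_sums_local (hRA i) hKAi0 hKAiN (hN1 (by omega)) le_rfl (v := SA i e) (j := j) (n := m) hε0 hεj
          (fun m' hm' hm'j => ihd m' (by omega) hm'j) (H := HgS (i - 1) j)
          (fun m' hm' _ => hgrowε m' fun p hp hpj => ihd p (by omega) hpj) zero_le_one
          (fun hjm L' hL' => by rw [one_mul]; exact hSc i m j hi1 hin hPi hjm L' hL')
          (fun L hL hLN L' hL' => by rw [one_mul, ← hL]; exact hScp i m L hi1 hin hPi hLN L' hL')
      rw [(hSA i e het).2 m, (hSA i e het).2 (m + 1)]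
      have e1 : e m = 1 := if_pos (by omega)
      have e2 : e (m + 1) = 1 := if_pos (by omega)
      rw [e1, e2]
      linarith

end Summit.QuantumFields.BalabanUV.Beta.EriceRemainderEnclosureHistoryAutonomyComparisonAgeCompositionStaticEndEntering

end
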